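import Literature.NumberTheory.EllipticCurves.IwasawaTwistModP
import Literature.NumberTheory.GaloisCohomology.PairingTateDual
import HarnessLib

/-!
# The Gorenstein (convolution) pairing `𝒯_J(ρ, κ) × 𝒯_J(ρ′, κ⁻¹) → P` of two Iwasawa twists and the
# Tate dual `𝒯_J^* ≅ 𝒯_J(ρ^*(1), κ⁻¹)` (MU-TRANSFER-PROOF (F7), (4.1), (4.2); definitions + proofs, no fact)

Topic `NumberTheory/EllipticCurves` (sequel of `IwasawaTwistModP`); namespaces
`Literature.NumberTheory.EllipticCurves` (pure algebra) and `….ZpExtension`.  Cell `bsd-smallim`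
(rung K6 of `BirchSwinnertonDyer`, class X9, crux `MuTransferX9` = item 19276, stub `stub_coreX9`), seat
`bsd-smallim-k6-ty` (typer), CORE-PLAN (k6-c2) **S2.2 [MISSING-VOCAB]**: "the dual `𝒯_J^* = Hom(𝒯_J, μ_p)`
= `tateDual (W.modPTwist W p κ J) p`, the identification (4.1) `𝒯_J^* ≅ E[p]^*(1) ⊗ A_J(χ^{-1})`, and the
Gorenstein pairing (F7) `⟨x,x*⟩_{A_J} = Σ_i x*(T^{J−1−i}x)T^i` — its `i`-th coefficient is the Tate pairing
of `((S^{J-1-i})_* x, x*)`".  DEFINITIONS WITH BODIES AND THEOREMS ONLY — nothing is asserted (D-0026).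

Let `e : M × M′ → P` be a bi-additive pairing (`e : M →+ M′ →+ P`; intended: the Weil pairing
`E[p] × E[p] → μ_p`, or the evaluation `M × M^*(1) → μ_p`) and `J : ℕ`.  On the coordinate models
`Fin J → M`, `Fin J → M′` (coefficients of `1, T, …, T^{J−1}`, file `IwasawaTwistModP`):

* `coeffFun x a` — the `a`-th coefficient of `x` extended by `0` to all `a : ℕ`; `coeffFun_shiftEnd`
  (`(T·x)_a = x_{a−1}`, `(T·x)_0 = 0`).
* **`convCoeff e J k x y = Σ_{a+b=k} e(x_a, y_b)`** — the `k`-th CONVOLUTION COEFFICIENT of `x` and `y`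
  (the coefficient of `T^k` in the product `x(T)·y(T)` computed through `e`), bi-additive
  (`convCoeffHom`).  `convCoeff_shiftEnd_left/right`: `C_{k+1}(T x, y) = C_k(x, y) = C_{k+1}(x, T y)` for
  `k + 1 < J`, `C_0(T x, y) = 0 = C_0(x, T y)`: **`T` is self-adjoint**; `convCoeff_unipotentPow`
  (`C_k((1+T)^a x, y) = C_k(x, (1+T)^a y)`), `convCoeff_map` (`C_k(f∘x, f′∘y) = g(C_k(x,y))` for maps
  intertwining `e`).
* **`gorensteinPairing e J := convCoeff e J (J − 1)`** — the TOP convolution coefficient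
  `B(x, y) = Σ_{i+j=J−1} e(x_i, y_j) = Σ_i e(x_i, y_{J−1−i})` (`gorensteinPairing_eq_sum_rev`): the
  `μ_p`-component of MU-TRANSFER-PROOF (F7)/(4.2) (`⟨v⊗a, [w′⊗b]⟩_{A_J} = w′(v)·ab`, top coefficient =
  evaluation); and **`gorensteinPairing_shiftEnd_pow_left`: `B(T^m x, y) = C_{J−1−m}(x, y)`** — the
  coefficient of `T^i` in `⟨x, x*⟩_{A_J} = Σ_i x*(T^{J−1−i}x) T^i` IS the `i`-th convolution coefficient
  (the `hpair0`/`hpair1` shape of the kernel schema `Rank1Residual.LevelE.theoremA_contradiction_schema`).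
* `ZpExtension.invTwist κ = κ⁻¹` (`unitTwist (−1)`; same layers) and
  `prime_pow_dvd_twistExponent_add_invTwist` (`p^J ∣ e_J(g) + e_J^{κ⁻¹}(g)`).
* **`gorensteinPairing_twistModP_smul`** — for `Γ_K`-modules `ρ, ρ′, ρ_P` with
  `e(ρ g m, ρ′ g m′) = ρ_P g (e(m, m′))`: **`B(g·x, g·y) = g·B(x, y)`** for the twist actions of
  `κ.twistModP ρ hM J` and `κ⁻¹.twistModP ρ′ hM′ J` — THE DUAL DEFORMATION CARRIES `χ⁻¹` ((4.1)); packaged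
  as a continuous pairing `twistContPairing` (tree `DiscreteGaloisModule.pairing`, so that the tree's
  cup product `∪_B` and `cupProduct_pairing_eq_tateDualPairing` / Poitou–Tate local terms apply) and as
  the **equivariant dual map `twistDualMap : 𝒯_J(ρ′, κ⁻¹) →ⁱ (𝒯_J(ρ, κ))^D = tateDual _ n`**
  (`pairingDualIntertwining`), with `twistDualMap_injective` / `_surjective` / `_bijective` when `e` is
  right-non-degenerate / right-surjective onto `Hom(M, P)` (perfect): (4.1) "`E[p]^*(1) ⊗ A_e(χ⁻¹) ⥲ 𝒯_e^*`".

Elliptic curves: with `ρ = ρ′ = W.torsionGaloisModule p`, `e` the Weil pairing into `μ_p` (tree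
`WeilPairingTateDual.lean`), `𝒯_J(E)^* ≅ 𝒯_J(E)` twisted by `κ⁻¹` — left to the consumer (one line of
instantiation once the Weil pairing's perfectness facts are chosen).

References: HOME/koly/MU-TRANSFER-PROOF.md (F7), §4 (4.1)–(4.2); B. Mazur, K. Rubin, *Kolyvagin systems*,
Mem. AMS 799 (2004) §1.3 (Tate dual `T^* = Hom(T, μ_{p^∞})`), §5.3 [MazurRubin2004]; B. Howard,
Compositio 140 (2004) Prop. 3.2.4 (`e_Λ(λt, a) = e_Λ(t, λ^ι a)`) [Howard2004HeegnerKolyvagin];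
J. S. Milne, *Arithmetic Duality Theorems* (2006) I §0 (`Hom(M, N)` with `(σf)(m) = σ f(σ⁻¹ m)`)
[MilneADT2006]; L. Washington, *Introduction to Cyclotomic Fields* §13.2 [Washington1997].
-/

noncomputable section

open scoped ContRepresentation
open Field Finset

universe u

namespace Literature.NumberTheory.EllipticCurves

open Literature.NumberTheory.GaloisRepresentations
open Literature.NumberTheory.GaloisRepresentations.DiscreteGaloisModule (pairing TateDual tateDual
  pairingDualHom pairingDualIntertwining)

/-! ## Coefficients extended by zero and convolution coefficients (pure algebra) -/

section Convolution

variable {M M' P : Type*} [AddCommGroup M] [AddCommGroup M'] [AddCommGroup P]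
  (e : M →+ M' →+ P) (J : ℕ)

/-- The `a`-th coefficient of `x : Fin J → M` (coefficient of `T^a`), extended by `0` for `a ≥ J`.
[cite: Washington1997, §13.1–§13.2] -/
def coeffFun (x : Fin J → M) (a : ℕ) : M := if h : a < J then x ⟨a, h⟩ else 0

variable {J}

/-- Unfolding lemma for `coeffFun` below `J`. [cite: Washington1997, §13.1–§13.2] -/
theorem coeffFun_of_lt (x : Fin J → M) {a : ℕ} (h : a < J) : coeffFun J x a = x ⟨a, h⟩ := dif_pos h

/-- `coeffFun x i = x i` for `i : Fin J`. [cite: Washington1997, §13.1–§13.2] -/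
@[simp] theorem coeffFun_val (x : Fin J → M) (i : Fin J) : coeffFun J x i = x i := by
  rw [coeffFun_of_lt x i.2]

/-- Unfolding lemma for `coeffFun` at and above `J`. [cite: Washington1997, §13.1–§13.2] -/
theorem coeffFun_of_le (x : Fin J → M) {a : ℕ} (h : J ≤ a) : coeffFun J x a = 0 := dif_neg (not_lt.2 h)

/-- `coeffFun` is additive in `x`. [cite: Washington1997, §13.1–§13.2] -/
@[simp] theorem coeffFun_add (x x' : Fin J → M) (a : ℕ) :
    coeffFun J (x + x') a = coeffFun J x a + coeffFun J x' a := by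
  unfold coeffFun; split_ifs <;> simp

/-- `coeffFun 0 = 0`. [cite: Washington1997, §13.1–§13.2] -/
@[simp] theorem coeffFun_zero (a : ℕ) : coeffFun J (0 : Fin J → M) a = 0 := by
  unfold coeffFun; split_ifs <;> simp

/-- Coefficients of `T·x`: `(T x)_0 = 0` and `(T x)_{a+1} = x_a` for `a + 1 < J`.
[cite: Washington1997, §13.1–§13.2] -/
theorem coeffFun_shiftEnd_succ (x : Fin J → M) {a : ℕ} (h : a + 1 < J) :
    coeffFun J (shiftEnd M J x) (a + 1) = coeffFun J x a := by
  rw [coeffFun_of_lt _ h, coeffFun_of_lt _ (by omega), shiftEnd_apply, dif_neg (by simp)]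
  rfl

/-- `(T x)_0 = 0`. [cite: Washington1997, §13.1–§13.2] -/
theorem coeffFun_shiftEnd_zero (x : Fin J → M) : coeffFun J (shiftEnd M J x) 0 = 0 := by
  unfold coeffFun
  split_ifs with h
  · rw [shiftEnd_apply, dif_pos rfl]
  · rfl

/-- Coefficients commute with coordinatewise maps. [cite: Washington1997, §13.1–§13.2] -/
theorem coeffFun_map {N : Type*} [AddCommGroup N] (f : M →+ N) (x : Fin J → M) (a : ℕ) :
    coeffFun J (fun i => f (x i)) a = f (coeffFun J x a) := by
  unfold coeffFun; split_ifs <;> simp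

variable (J)

/-- **The `k`-th convolution coefficient** `C_k(x, y) = Σ_{a+b=k} e(x_a, y_b)` of `x : Fin J → M` and
`y : Fin J → M′` through the pairing `e` — the coefficient of `T^k` of "`x(T)·y(T)`"; for `k ≤ J − 1` it
is the coefficient of `T^k` in the Gorenstein pairing `⟨x, y⟩_{A_J}` of MU-TRANSFER-PROOF (F7)
(`gorensteinPairing_shiftEnd_pow_left`). [cite: MazurRubin2004, §1.3 and §5.3] -/
def convCoeff (k : ℕ) (x : Fin J → M) (y : Fin J → M') : P :=
  ∑ a ∈ range (k + 1), e (coeffFun J x a) (coeffFun J y (k - a))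

/-- Unfolding lemma for `convCoeff`. [cite: MazurRubin2004, §1.3 and §5.3] -/
theorem convCoeff_def (k : ℕ) (x : Fin J → M) (y : Fin J → M') :
    convCoeff e J k x y = ∑ a ∈ range (k + 1), e (coeffFun J x a) (coeffFun J y (k - a)) := rfl

/-- `C_k` is additive in `x`. [cite: MazurRubin2004, §1.3 and §5.3] -/
theorem convCoeff_add_left (k : ℕ) (x x' : Fin J → M) (y : Fin J → M') :
    convCoeff e J k (x + x') y = convCoeff e J k x y + convCoeff e J k x' y := by
  simp [convCoeff, sum_add_distrib]

/-- `C_k` is additive in `y`. [cite: MazurRubin2004, §1.3 and §5.3] -/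
theorem convCoeff_add_right (k : ℕ) (x : Fin J → M) (y y' : Fin J → M') :
    convCoeff e J k x (y + y') = convCoeff e J k x y + convCoeff e J k x y' := by
  simp [convCoeff, sum_add_distrib]

/-- `C_k(x, ·)` vanishes at `0`. [cite: MazurRubin2004, §1.3 and §5.3] -/
@[simp] theorem convCoeff_zero_right (k : ℕ) (x : Fin J → M) : convCoeff e J k x 0 = 0 := by
  simp [convCoeff]

/-- `C_k(·, y)` vanishes at `0`. [cite: MazurRubin2004, §1.3 and §5.3] -/
@[simp] theorem convCoeff_zero_left (k : ℕ) (y : Fin J → M') : convCoeff e J k 0 y = 0 := by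
  simp [convCoeff]

/-- `C_k` as a bi-additive map. [cite: MazurRubin2004, §1.3 and §5.3] -/
def convCoeffHom (k : ℕ) : (Fin J → M) →+ (Fin J → M') →+ P where
  toFun x :=
    { toFun := convCoeff e J k x
      map_zero' := convCoeff_zero_right e J k x
      map_add' := convCoeff_add_right e J k x }
  map_zero' := AddMonoidHom.ext fun y => convCoeff_zero_left e J k y
  map_add' x x' := AddMonoidHom.ext fun y => convCoeff_add_left e J k x x' y

/-- Unfolding lemma for `convCoeffHom`. [cite: MazurRubin2004, §1.3 and §5.3] -/
@[simp] theorem convCoeffHom_apply (k : ℕ) (x : Fin J → M) (y : Fin J → M') :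
    convCoeffHom e J k x y = convCoeff e J k x y := rfl

variable {J}

/-- **`T` lowers the convolution index on the left**: `C_{k+1}(T x, y) = C_k(x, y)` for `k + 1 < J`.
[cite: MazurRubin2004, §1.3 and §5.3] -/
theorem convCoeff_succ_shiftEnd_left {k : ℕ} (hk : k + 1 < J) (x : Fin J → M) (y : Fin J → M') :
    convCoeff e J (k + 1) (shiftEnd M J x) y = convCoeff e J k x y := by
  rw [convCoeff_def, sum_range_succ', coeffFun_shiftEnd_zero, map_zero, AddMonoidHom.zero_apply,
    add_zero, convCoeff_def]
  refine sum_congr rfl fun a ha => ?_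
  rw [mem_range] at ha
  rw [coeffFun_shiftEnd_succ x (by omega), show k + 1 - (a + 1) = k - a by omega]

/-- **`T` lowers the convolution index on the right**: `C_{k+1}(x, T y) = C_k(x, y)` for `k + 1 < J`.
[cite: MazurRubin2004, §1.3 and §5.3] -/
theorem convCoeff_succ_shiftEnd_right {k : ℕ} (hk : k + 1 < J) (x : Fin J → M) (y : Fin J → M') :
    convCoeff e J (k + 1) x (shiftEnd M' J y) = convCoeff e J k x y := by
  rw [convCoeff_def, sum_range_succ, Nat.sub_self, coeffFun_shiftEnd_zero, map_zero, add_zero,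
    convCoeff_def]
  refine sum_congr rfl fun a ha => ?_
  rw [mem_range] at ha
  rw [show k + 1 - a = (k - a) + 1 by omega, coeffFun_shiftEnd_succ y (by omega)]

/-- `C_0(T x, y) = 0`. [cite: MazurRubin2004, §1.3 and §5.3] -/
theorem convCoeff_zero_shiftEnd_left (x : Fin J → M) (y : Fin J → M') :
    convCoeff e J 0 (shiftEnd M J x) y = 0 := by
  rw [convCoeff_def, sum_range_one, coeffFun_shiftEnd_zero, map_zero, AddMonoidHom.zero_apply]

/-- `C_0(x, T y) = 0`. [cite: MazurRubin2004, §1.3 and §5.3] -/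
theorem convCoeff_zero_shiftEnd_right (x : Fin J → M) (y : Fin J → M') :
    convCoeff e J 0 x (shiftEnd M' J y) = 0 := by
  rw [convCoeff_def, sum_range_one, Nat.sub_zero, coeffFun_shiftEnd_zero, map_zero]

/-- **`T` is self-adjoint for every convolution coefficient of index `< J`**:
`C_k(T x, y) = C_k(x, T y)` (`k < J`).  [cite: Howard2004HeegnerKolyvagin, Prop. 3.2.4] -/
theorem convCoeff_shiftEnd_comm {k : ℕ} (hk : k < J) (x : Fin J → M) (y : Fin J → M') :
    convCoeff e J k (shiftEnd M J x) y = convCoeff e J k x (shiftEnd M' J y) := by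
  cases k with
  | zero => rw [convCoeff_zero_shiftEnd_left, convCoeff_zero_shiftEnd_right]
  | succ k => rw [convCoeff_succ_shiftEnd_left e hk, convCoeff_succ_shiftEnd_right e hk]

/-- Hence every power of `T` is self-adjoint for `C_k`, `k < J`. [cite: Howard2004HeegnerKolyvagin, Prop. 3.2.4] -/
theorem convCoeff_shiftEnd_pow_comm {k : ℕ} (hk : k < J) (m : ℕ) (x : Fin J → M) (y : Fin J → M') :
    convCoeff e J k ((shiftEnd M J ^ m) x) y = convCoeff e J k x ((shiftEnd M' J ^ m) y) := by
  induction m generalizing x y with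
  | zero => simp
  | succ m ih =>
    rw [pow_succ', Module.End.mul_apply, convCoeff_shiftEnd_comm e hk, ih, ← Module.End.mul_apply,
      ← pow_succ]

/-- Hence the unipotent operators `(1+T)^a` are self-adjoint for `C_k`, `k < J`:
`C_k((1+T)^a x, y) = C_k(x, (1+T)^a y)`. [cite: Howard2004HeegnerKolyvagin, Prop. 3.2.4] -/
theorem convCoeff_unipotentPow_comm {k : ℕ} (hk : k < J) (a : ℕ) (x : Fin J → M) (y : Fin J → M') :
    convCoeff e J k (unipotentPow M J a x) y = convCoeff e J k x (unipotentPow M' J a y) := by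
  induction a generalizing x y with
  | zero => simp
  | succ a ih =>
    have hc : unipotentPow M' J a (shiftEnd M' J y) = shiftEnd M' J (unipotentPow M' J a y) := by
      have := LinearMap.congr_fun (commute_shiftEnd_unipotentPow (M := M') (J := J) a).eq y
      simpa [Module.End.mul_apply] using this.symm
    rw [ZpExtension.unipotentPow_succ_apply, ZpExtension.unipotentPow_succ_apply, convCoeff_add_left,
      convCoeff_add_right, convCoeff_shiftEnd_comm e hk, ih, ih, hc]

/-- **Equivariance under coordinatewise maps intertwining `e`**: if `e(f m, f′ m′) = g(e(m, m′))` then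
`C_k(f∘x, f′∘y) = g(C_k(x, y))`. [cite: MilneADT2006, Ch. I §0] -/
theorem convCoeff_map {f : M →+ M} {f' : M' →+ M'} {g : P →+ P}
    (he : ∀ m m', e (f m) (f' m') = g (e m m')) (k : ℕ) (x : Fin J → M) (y : Fin J → M') :
    convCoeff e J k (fun i => f (x i)) (fun i => f' (y i)) = g (convCoeff e J k x y) := by
  rw [convCoeff_def, convCoeff_def, map_sum]
  refine sum_congr rfl fun a _ => ?_
  rw [coeffFun_map, coeffFun_map, he]

variable (J)

/-- **The Gorenstein pairing** `B(x, y) := C_{J−1}(x, y) = Σ_{i+j=J−1} e(x_i, y_j)`: the TOP convolution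
coefficient — the `P`-valued (`μ_p`-valued) component of MU-TRANSFER-PROOF (F7)
`⟨x, x*⟩_{A_J} = Σ_i x*(T^{J−1−i} x) T^i` (whose top coefficient is the evaluation `x*(x)`, (4.2):
`⟨v⊗a, [w′⊗b]⟩ = w′(v)·ab`). [cite: MazurRubin2004, §1.3 and §5.3] -/
def gorensteinPairing : (Fin J → M) →+ (Fin J → M') →+ P := convCoeffHom e J (J - 1)

/-- Unfolding lemma for `gorensteinPairing`. [cite: MazurRubin2004, §1.3 and §5.3] -/
@[simp] theorem gorensteinPairing_apply (x : Fin J → M) (y : Fin J → M') :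
    gorensteinPairing e J x y = convCoeff e J (J - 1) x y := rfl

variable {J}

/-- `B(x, y) = Σ_i e(x_i, y_{J−1−i})` as a sum over `Fin J` (`Fin.rev`). [cite: MazurRubin2004, §1.3 and §5.3] -/
theorem gorensteinPairing_eq_sum_rev (x : Fin J → M) (y : Fin J → M') :
    gorensteinPairing e J x y = ∑ i : Fin J, e (x i) (y (Fin.rev i)) := by
  rcases Nat.eq_zero_or_pos J with hJ | hJ
  · subst hJ
    simp [convCoeff, coeffFun]
  · rw [gorensteinPairing_apply, convCoeff_def, show J - 1 + 1 = J by omega,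
      ← Fin.sum_univ_eq_sum_range (fun a => e (coeffFun J x a) (coeffFun J y (J - 1 - a)))]
    refine sum_congr rfl fun i _ => ?_
    rw [coeffFun_val, coeffFun_of_lt y (by omega)]
    congr 2
    exact Fin.ext (by simp [Fin.val_rev]; omega)

/-- `B` on a vector supported in one coordinate: `B(δ_i m, y) = e(m, y_{J−1−i})`.
[cite: MazurRubin2004, §1.3 and §5.3] -/
theorem gorensteinPairing_single_left [DecidableEq (Fin J)] (i : Fin J) (m : M) (y : Fin J → M') :
    gorensteinPairing e J (Pi.single i m) y = e m (y (Fin.rev i)) := by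
  rw [gorensteinPairing_eq_sum_rev, sum_eq_single i]
  · rw [Pi.single_eq_same]
  · intro j _ hj
    rw [Pi.single_eq_of_ne hj, map_zero, AddMonoidHom.zero_apply]
  · intro h
    exact absurd (mem_univ i) h

/-- **`T` is self-adjoint for the Gorenstein pairing**: `B(T x, y) = B(x, T y)`.
[cite: Howard2004HeegnerKolyvagin, Prop. 3.2.4] -/
theorem gorensteinPairing_shiftEnd_comm (x : Fin J → M) (y : Fin J → M') :
    gorensteinPairing e J (shiftEnd M J x) y = gorensteinPairing e J x (shiftEnd M' J y) := by
  rcases Nat.eq_zero_or_pos J with hJ | hJ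
  · subst hJ
    simp [convCoeff, coeffFun]
  · exact convCoeff_shiftEnd_comm e (by omega) x y

/-- `(1+T)^a` is self-adjoint for `B`. [cite: Howard2004HeegnerKolyvagin, Prop. 3.2.4] -/
theorem gorensteinPairing_unipotentPow_comm (a : ℕ) (x : Fin J → M) (y : Fin J → M') :
    gorensteinPairing e J (unipotentPow M J a x) y = gorensteinPairing e J x (unipotentPow M' J a y) := by
  rcases Nat.eq_zero_or_pos J with hJ | hJ
  · subst hJ
    simp [convCoeff, coeffFun]
  · exact convCoeff_unipotentPow_comm e (by omega) a x y

/-- **The coefficients of the `A_J`-valued Gorenstein pairing are the convolution coefficients**: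
`B(T^m x, y) = C_{J−1−m}(x, y)` for `m < J` — i.e. the coefficient of `T^i` in
`⟨x, x*⟩_{A_J} = Σ_i x*(T^{J−1−i} x) T^i` is `C_i(x, y) = Σ_{a+b=i} e(x_a, y_b)` (so the constant term is
`e(x_0, y_0)` and the `T¹`-coefficient `e(x_0, y_1) + e(x_1, y_0)`: the inputs `hpair0`, `hpair1` of the
kernel schema `Rank1Residual.LevelE.theoremA_contradiction_schema`). [cite: MazurRubin2004, §1.3 and §5.3] -/
theorem gorensteinPairing_shiftEnd_pow_left {m : ℕ} (hm : m < J) (x : Fin J → M) (y : Fin J → M') :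
    gorensteinPairing e J ((shiftEnd M J ^ m) x) y = convCoeff e J (J - 1 - m) x y := by
  rw [gorensteinPairing_apply]
  induction m generalizing x with
  | zero => simp
  | succ m ih =>
    rw [pow_succ, Module.End.mul_apply, ih (by omega) (shiftEnd M J x),
      show J - 1 - m = (J - 1 - (m + 1)) + 1 by omega, convCoeff_succ_shiftEnd_left e (by omega)]

/-- The constant term: `C_0(x, y) = e(x_0, y_0)` (`0 < J`). [cite: MazurRubin2004, §1.3 and §5.3] -/
theorem convCoeff_zero (hJ : 0 < J) (x : Fin J → M) (y : Fin J → M') :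
    convCoeff e J 0 x y = e (x ⟨0, hJ⟩) (y ⟨0, hJ⟩) := by
  rw [convCoeff_def, sum_range_one, Nat.sub_zero, coeffFun_of_lt x hJ, coeffFun_of_lt y hJ]

/-- The `T¹`-coefficient: `C_1(x, y) = e(x_0, y_1) + e(x_1, y_0)` (`1 < J`). [cite: MazurRubin2004, §1.3 and §5.3] -/
theorem convCoeff_one (hJ : 1 < J) (x : Fin J → M) (y : Fin J → M') :
    convCoeff e J 1 x y = e (x ⟨0, by omega⟩) (y ⟨1, hJ⟩) + e (x ⟨1, hJ⟩) (y ⟨0, by omega⟩) := by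
  rw [convCoeff_def, sum_range_succ, sum_range_one, Nat.sub_zero, Nat.sub_self,
    coeffFun_of_lt x (by omega : 0 < J), coeffFun_of_lt y hJ, coeffFun_of_lt x hJ,
    coeffFun_of_lt y (by omega : 0 < J)]

/-! ### Non-degeneracy of `B` in the second variable from that of `e` -/

/-- **`B(·, y) = 0 ⟹ y = 0`** when `e` is right-non-degenerate. [cite: MilneADT2006, Ch. I §0] -/
theorem gorensteinPairing_right_nondegenerate (he : ∀ m', (∀ m, e m m' = 0) → m' = 0)
    (y : Fin J → M') (hy : ∀ x, gorensteinPairing e J x y = 0) : y = 0 := by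
  classical
  funext j
  rw [Pi.zero_apply]
  refine he _ fun m => ?_
  have := hy (Pi.single (Fin.rev j) m)
  rwa [gorensteinPairing_single_left, Fin.rev_rev] at this

/-- **Every `φ : (Fin J → M) →+ P` is `B(·, y)`** when `e` is right-surjective onto `Hom(M, P)`:
`y_{J−1−i}` represents `φ ∘ δ_i`. [cite: MilneADT2006, Ch. I §0] -/
theorem gorensteinPairing_right_surjective (he : ∀ φ : M →+ P, ∃ m', ∀ m, e m m' = φ m)
    (φ : (Fin J → M) →+ P) : ∃ y : Fin J → M', ∀ x, gorensteinPairing e J x y = φ x := by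
  classical
  choose r hr using he
  refine ⟨fun j => r (φ.comp (AddMonoidHom.single (fun _ : Fin J => M) (Fin.rev j))), fun x => ?_⟩
  rw [gorensteinPairing_eq_sum_rev]
  simp only [Fin.rev_rev, hr, AddMonoidHom.comp_apply, AddMonoidHom.single_apply]
  rw [← map_sum, Finset.univ_sum_single]

end Convolution

/-! ## The inverse twist `κ⁻¹` and the equivariance of the Gorenstein pairing -/

namespace ZpExtension

variable {K : Type u} [Field K] {p : ℕ} [Fact p.Prime] (κ : ZpExtension K p)

/-- **The inverse `ℤ_p`-extension character `κ⁻¹`** (`g ↦ −κ(g)` in additive notation): the unit twist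
by `−1 ∈ ℤ_pˣ`; same kernel and layers (`layerSubgroup_unitTwist`).  The dual of a `κ`-twist is a
`κ⁻¹`-twist ((4.1): "THE DUAL DEFORMATION CARRIES `χ⁻¹`"). [cite: Washington1997, §13.1–§13.2] -/
abbrev invTwist : ZpExtension K p := κ.unitTwist (-1)

/-- `κ⁻¹(g) = −κ(g)`. [cite: Washington1997, §13.1–§13.2] -/
@[simp] theorem toAdd_invTwist_apply (g : absoluteGaloisGroup K) :
    (κ.invTwist g).toAdd = -(κ g).toAdd := by
  rw [invTwist, unitTwist_apply, toAdd_ofAdd, Units.val_neg, Units.val_one, neg_one_mul]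

/-- The layers of `κ⁻¹` are those of `κ`. [cite: Washington1997, §13.1–§13.2] -/
theorem layerSubgroup_invTwist (n : ℕ) : κ.invTwist.layerSubgroup n = κ.layerSubgroup n :=
  κ.layerSubgroup_unitTwist (-1) n

/-- **`p^J ∣ e_J(g) + e_J^{κ⁻¹}(g)`**: the twist exponents of `κ` and `κ⁻¹` at level `J` are opposite
modulo `p^J`, so `(1+S)^{e_J(g)} (1+S)^{e_J^{κ⁻¹}(g)} = 1` on `Fin J → M` (`p·M = 0`).
[cite: Washington1997, §13.1–§13.2] -/
theorem prime_pow_dvd_twistExponent_add_invTwist (J : ℕ) (g : absoluteGaloisGroup K) :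
    p ^ J ∣ κ.twistExponent J g + κ.invTwist.twistExponent J g := by
  rw [← ZMod.natCast_eq_zero_iff, Nat.cast_add, twistExponent, twistExponent, ZMod.natCast_zmod_val,
    ZMod.natCast_zmod_val, toAdd_invTwist_apply, map_neg, add_neg_cancel]

variable {M M' P : Type u} [AddCommGroup M] [TopologicalSpace M] [DiscreteTopology M]
  [AddCommGroup M'] [TopologicalSpace M'] [DiscreteTopology M']
  [AddCommGroup P] [TopologicalSpace P] [DiscreteTopology P]
  (ρ : DiscreteGaloisModule K M) (ρ' : DiscreteGaloisModule K M') (ρP : DiscreteGaloisModule K P)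
  (hM : ∀ x : M, p • x = 0) (hM' : ∀ x : M', p • x = 0) (J : ℕ)
  {e : M →+ M' →+ P}
  (he : ∀ (g : absoluteGaloisGroup K) (m : M) (m' : M'), e (ρ g m) (ρ' g m') = ρP g (e m m'))

include he in
/-- **The Gorenstein pairing is `Γ_K`-equivariant for the twists `𝒯_J(ρ, κ) × 𝒯_J(ρ′, κ⁻¹) → P`**:
`B(g·x, g·y) = g·B(x, y)`, where `g` acts on `x` by `(1+S)^{κ(g)} ∘ ρ(g)` and on `y` by
`(1+S)^{−κ(g)} ∘ ρ′(g)` — the unipotent parts cancel because `(1+S)` is self-adjoint for `B`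
(`gorensteinPairing_unipotentPow_comm`) and `(1+S)^{p^J} = 1`.  MU-TRANSFER-PROOF (4.1): the dual of
`E[p] ⊗ A_J(χ)` is `E[p]^*(1) ⊗ A_J(χ^{-1})`. [cite: Howard2004HeegnerKolyvagin, Prop. 3.2.4]
[cite: MazurRubin2004, §1.3 and §5.3] -/
theorem gorensteinPairing_twistModP_smul (g : absoluteGaloisGroup K) (x : Fin J → M) (y : Fin J → M') :
    gorensteinPairing e J (κ.twistModP ρ hM J g x) (κ.invTwist.twistModP ρ' hM' J g y) =
      ρP g (gorensteinPairing e J x y) := by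
  have hJ : J ≤ p ^ J := (Nat.lt_pow_self (Fact.out : p.Prime).one_lt).le
  rw [twistModP_apply, twistModP_apply, gorensteinPairing_unipotentPow_comm, ← Module.End.mul_apply,
    ← unipotentPow_add,
    unipotentPow_eq_one_of_dvd hM' hJ (κ.prime_pow_dvd_twistExponent_add_invTwist J g),
    Module.End.one_apply, gorensteinPairing_apply, gorensteinPairing_apply]
  exact convCoeff_map e (f := (ρ g : M →ₗ[ℤ] M).toAddMonoidHom) (f' := (ρ' g : M' →ₗ[ℤ] M').toAddMonoidHom)
    (g := (ρP g : P →ₗ[ℤ] P).toAddMonoidHom) (fun m m' => he g m m') _ x y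

/-- **The Gorenstein pairing as a continuous `Γ_K`-equivariant pairing of the twists**
`𝒯_J(ρ, κ) × 𝒯_J(ρ′, κ⁻¹) → P` (tree `DiscreteGaloisModule.pairing`; feeds the tree's cup product
`ContPairing.cupProduct`, `cupProduct_pairing_eq_tateDualPairing` and the Poitou–Tate local terms
`sum_inv_localization_cupProduct_pairing_eq_zero`). [cite: MazurRubin2004, §1.3 and §5.3] -/
def twistContPairing :
    ContPairing (κ.twistModP ρ hM J).toTopRep (κ.invTwist.twistModP ρ' hM' J).toTopRep ρP.toTopRep :=
  pairing (κ.twistModP ρ hM J) (κ.invTwist.twistModP ρ' hM' J) ρP (gorensteinPairing e J)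
    (κ.gorensteinPairing_twistModP_smul ρ ρ' ρP hM hM' J he)

/-- Unfolding lemma for `twistContPairing`. [cite: MazurRubin2004, §1.3 and §5.3] -/
@[simp] theorem twistContPairing_toLin_apply (x : Fin J → M) (y : Fin J → M') :
    (κ.twistContPairing ρ ρ' ρP hM hM' J he).toLin x y = gorensteinPairing e J x y := rfl

end ZpExtension

/-! ## The Tate dual of a twist: `𝒯_J(ρ′, κ⁻¹) → (𝒯_J(ρ, κ))^D = Hom(𝒯_J, μ_n)` -/

namespace ZpExtension

variable {K : Type u} [Field K] {p : ℕ} [Fact p.Prime] (κ : ZpExtension K p)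
  {M M' : Type u} [AddCommGroup M] [TopologicalSpace M] [DiscreteTopology M] [Finite M]
  [AddCommGroup M'] [TopologicalSpace M'] [DiscreteTopology M']
  (ρ : DiscreteGaloisModule K M) (ρ' : DiscreteGaloisModule K M') (n : ℕ)
  (hM : ∀ x : M, p • x = 0) (hM' : ∀ x : M', p • x = 0) (J : ℕ)
  {e : M →+ M' →+ DiscreteGaloisModule.MuCarrier K n}
  (he : ∀ (g : absoluteGaloisGroup K) (m : M) (m' : M'),
    e (ρ g m) (ρ' g m') = DiscreteGaloisModule.mu K n g (e m m'))

/-- **The dual map `𝒯_J(ρ′, κ⁻¹) → 𝒯_J(ρ, κ)^D = Hom(𝒯_J(ρ, κ), μ_n)`, `y ↦ B(·, y)`, as a continuous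
`Γ_K`-equivariant map** into the tree's Tate dual `tateDual (κ.twistModP ρ hM J) n` (action
`(σf)(x) = σ f(σ⁻¹ x)`), via the tree's `pairingDualIntertwining`.  For `M = M′ = E[p]`, `e` the Weil
pairing, `n = p`: MU-TRANSFER-PROOF (4.1) `E[p]^*(1) ⊗ A_J(χ^{-1}) → 𝒯_J^*`. [cite: MazurRubin2004, §1.3 and §5.3]
[cite: MilneADT2006, Ch. I §0] -/
def twistDualMap :
    (κ.invTwist.twistModP ρ' hM' J).toContRepresentation →ⁱL
      ((κ.twistModP ρ hM J).tateDual n).toContRepresentation :=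
  pairingDualIntertwining (ρ₁ := κ.twistModP ρ hM J) (ρ₂ := κ.invTwist.twistModP ρ' hM' J) (n := n)
    (B := gorensteinPairing e J)
    (κ.gorensteinPairing_twistModP_smul ρ ρ' (DiscreteGaloisModule.mu K n) hM hM' J he)

/-- Unfolding lemma: `twistDualMap y x = B(x, y)`. [cite: MazurRubin2004, §1.3 and §5.3] -/
@[simp] theorem twistDualMap_apply_apply (y : Fin J → M') (x : Fin J → M) :
    κ.twistDualMap ρ ρ' n hM hM' J he y x = gorensteinPairing e J x y := rfl

/-- **`twistDualMap` is injective** when `e` is right-non-degenerate. [cite: MilneADT2006, Ch. I §0] -/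
theorem twistDualMap_injective (hnd : ∀ m', (∀ m, e m m' = 0) → m' = 0) :
    Function.Injective (κ.twistDualMap ρ ρ' n hM hM' J he) := by
  refine (injective_iff_map_eq_zero _).2 fun y hy => ?_
  exact gorensteinPairing_right_nondegenerate e hnd y fun x => by
    rw [← twistDualMap_apply_apply κ ρ ρ' n hM hM' J he, hy]; rfl

/-- **`twistDualMap` is surjective** when `e` is right-surjective onto `Hom(M, μ_n)`.
[cite: MilneADT2006, Ch. I §0] -/
theorem twistDualMap_surjective (hsurj : ∀ φ : M →+ DiscreteGaloisModule.MuCarrier K n, ∃ m', ∀ m, e m m' = φ m) :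
    Function.Surjective (κ.twistDualMap ρ ρ' n hM hM' J he) := by
  intro f
  obtain ⟨y, hy⟩ := gorensteinPairing_right_surjective e hsurj
    (f : (Fin J → M) →+ DiscreteGaloisModule.MuCarrier K n)
  exact ⟨y, TateDual.ext fun x => by rw [twistDualMap_apply_apply, hy]; rfl⟩

/-- **`𝒯_J(ρ′, κ⁻¹) ≅ 𝒯_J(ρ, κ)^D`** when `e : M × M′ → μ_n` is perfect on the right: MU-TRANSFER-PROOF
(4.1) "`E[p]^*(1) ⊗ A_e(χ^{-1}) ⥲ 𝒯_e^*`". [cite: MazurRubin2004, §1.3 and §5.3] [cite: MilneADT2006, Ch. I §0] -/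
theorem twistDualMap_bijective (hnd : ∀ m', (∀ m, e m m' = 0) → m' = 0)
    (hsurj : ∀ φ : M →+ DiscreteGaloisModule.MuCarrier K n, ∃ m', ∀ m, e m m' = φ m) :
    Function.Bijective (κ.twistDualMap ρ ρ' n hM hM' J he) :=
  ⟨κ.twistDualMap_injective ρ ρ' n hM hM' J he hnd, κ.twistDualMap_surjective ρ ρ' n hM hM' J he hsurj⟩

end ZpExtension

end Literature.NumberTheory.EllipticCurves

end
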